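import Mathlib
import HarnessLib
import Summits.Ventures.LatticeQCDFlow.Scoring.IndependentJointLimit

/-!
# JOINT convergence in distribution of INDEPENDENT VECTOR-valued statistics:
# `Xₙ ⇒ Z₁` in `E`, `Yₙ ⇒ Z₂` in `F`, `Xₙ ⟂ Yₙ`, `Z₁ ⟂ Z₂` ⇒ `(Xₙ, Yₙ) ⇒ (Z₁, Z₂)` in `E × F`

HONEST FRAMING: exact (Metropolis-corrected) sampling algorithms for lattice gauge theory;
figures of merit are autocorrelation/cost numbers at stated couplings and volumes; no
continuum-physics claim.

Venture `LatticeQCDFlow` (cell pub-lqcd), topic `Scoring`; FANOUT row 4 (`s0-u1-b`, GEN-32).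
NEW WORK of the cell (classical; not in Mathlib), no definition, nothing cited as a fact.
`Scoring/IndependentJointLimit.lean` proved the joint limit of two independent REAL statistics and
left "more than two components (iterate, or use `EuclideanSpace`)" NOT CLAIMED.  The two-chain
A-vs-B test at a FIXED number of batches compares two independent VECTORS of batch means (one per
run, `Scoring/BatchMeansJointCLT.lean`), so this file proves the vector version, for statistics with
values in finite-dimensional real inner product spaces `E`, `F`: if `Xₙ ⇒ Z₁` in `E`, `Yₙ ⇒ Z₂` in
`F`, `Xₙ ⟂ Yₙ` for every `n` and `Z₁ ⟂ Z₂`, then `(Xₙ, Yₙ) ⇒ (Z₁, Z₂)` in `E × F`.  Proof, as in the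
real case: read the pair in the inner product space `WithLp 2 (E × F)`, where
`⟪(s, t), (x, y)⟫ = ⟪s, x⟫ + ⟪t, y⟫` (Mathlib's `WithLp.prod_inner_apply`) and the Cramér–Wold device
(`Scoring/CramerWoldDevice.lean`) reduces joint convergence to that of the INDEPENDENT real sum
`⟪s, Xₙ⟫ + ⟪t, Yₙ⟫` (`Scoring/IndependentSumLimit.tendstoInDistribution_add_of_indepFun`, after the
forward Cramér–Wold direction on each component); return to `E × F` by the continuous `WithLp.ofLp`.
The two-codes form reads `Xₙ` on `P_A` and `Yₙ` on `P_B` along the product `P_A ⊗ P_B`.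

## Content

* `tendstoInDistribution_vector_comp_fst` / `_snd` — a statistic of one code keeps its limit when
  read on `P_A ⊗ P_B` (any Borel codomain);
* **`tendstoInDistribution_prodMk_of_indepFun_vector`** — the joint limit of independent components;
* **`tendstoInDistribution_prodMk_twoCodes_vector`** — the same for two codes on `P_A ⊗ P_B`.

NOT CLAIMED: infinitely many / dependent components; rates.
-/

noncomputable section

namespace Summit.Ventures.LatticeQCDFlow.Scoring.CardConsistency

open MeasureTheory ProbabilityTheory Filter WithLp
open scoped Topology RealInnerProductSpace

/-! ## §1 Reading one code's statistic on the product space -/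

section Product

variable {ΩA : Type*} [MeasurableSpace ΩA] {PA : Measure ΩA} [IsProbabilityMeasure PA]
variable {ΩB : Type*} [MeasurableSpace ΩB] {PB : Measure ΩB} [IsProbabilityMeasure PB]
variable {Ω' : Type*} [MeasurableSpace Ω'] {P' : Measure Ω'} [IsProbabilityMeasure P']
variable {S : Type*} [MeasurableSpace S] [TopologicalSpace S] [OpensMeasurableSpace S]

/-- A statistic of code `A` (values in any topological measurable space) keeps its limit when read
on `P_A ⊗ P_B`. [ours] -/
theorem tendstoInDistribution_vector_comp_fst {X : ℕ → ΩA → S} {Z : Ω' → S}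
    (hX : TendstoInDistribution X atTop Z (fun _ => PA) P') :
    TendstoInDistribution (fun n (ω : ΩA × ΩB) => X n ω.1) atTop Z (fun _ => PA.prod PB) P' := by
  have hm : ∀ n, AEMeasurable (fun ω : ΩA × ΩB => X n ω.1) (PA.prod PB) := fun n =>
    (hX.forall_aemeasurable n).comp_quasiMeasurePreserving Measure.quasiMeasurePreserving_fst
  refine ⟨hm, hX.aemeasurable_limit, ?_⟩
  have e : (fun n => (⟨(PA.prod PB).map fun ω : ΩA × ΩB => X n ω.1,
      Measure.isProbabilityMeasure_map (hm n)⟩ : ProbabilityMeasure S))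
      = fun n => ⟨PA.map (X n), Measure.isProbabilityMeasure_map (hX.forall_aemeasurable n)⟩ := by
    funext n
    apply Subtype.ext
    show (PA.prod PB).map (fun ω : ΩA × ΩB => X n ω.1) = PA.map (X n)
    have h1 : AEMeasurable (X n) ((PA.prod PB).map Prod.fst) := by
      rw [Measure.map_fst_prod, measure_univ, one_smul]
      exact hX.forall_aemeasurable n
    rw [show (fun ω : ΩA × ΩB => X n ω.1) = X n ∘ Prod.fst from rfl,
      ← AEMeasurable.map_map_of_aemeasurable h1 measurable_fst.aemeasurable,
      Measure.map_fst_prod, measure_univ, one_smul]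
  rw [e]
  exact hX.tendsto

/-- A statistic of code `B` keeps its limit when read on `P_A ⊗ P_B`. [ours] -/
theorem tendstoInDistribution_vector_comp_snd {Y : ℕ → ΩB → S} {Z : Ω' → S}
    (hY : TendstoInDistribution Y atTop Z (fun _ => PB) P') :
    TendstoInDistribution (fun n (ω : ΩA × ΩB) => Y n ω.2) atTop Z (fun _ => PA.prod PB) P' := by
  have hm : ∀ n, AEMeasurable (fun ω : ΩA × ΩB => Y n ω.2) (PA.prod PB) := fun n =>
    (hY.forall_aemeasurable n).comp_quasiMeasurePreserving Measure.quasiMeasurePreserving_snd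
  refine ⟨hm, hY.aemeasurable_limit, ?_⟩
  have e : (fun n => (⟨(PA.prod PB).map fun ω : ΩA × ΩB => Y n ω.2,
      Measure.isProbabilityMeasure_map (hm n)⟩ : ProbabilityMeasure S))
      = fun n => ⟨PB.map (Y n), Measure.isProbabilityMeasure_map (hY.forall_aemeasurable n)⟩ := by
    funext n
    apply Subtype.ext
    show (PA.prod PB).map (fun ω : ΩA × ΩB => Y n ω.2) = PB.map (Y n)
    have h1 : AEMeasurable (Y n) ((PA.prod PB).map Prod.snd) := by
      rw [Measure.map_snd_prod, measure_univ, one_smul]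
      exact hY.forall_aemeasurable n
    rw [show (fun ω : ΩA × ΩB => Y n ω.2) = Y n ∘ Prod.snd from rfl,
      ← AEMeasurable.map_map_of_aemeasurable h1 measurable_snd.aemeasurable,
      Measure.map_snd_prod, measure_univ, one_smul]
  rw [e]
  exact hY.tendsto

end Product

/-! ## §2 Joint convergence of independent vector components -/

section Joint

variable {E : Type*} [NormedAddCommGroup E] [InnerProductSpace ℝ E] [FiniteDimensional ℝ E]
  [MeasurableSpace E] [BorelSpace E]
variable {F : Type*} [NormedAddCommGroup F] [InnerProductSpace ℝ F] [FiniteDimensional ℝ F]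
  [MeasurableSpace F] [BorelSpace F]
variable {Ω : Type*} [MeasurableSpace Ω] {P : Measure Ω} [IsProbabilityMeasure P]
variable {Ω' : Type*} [MeasurableSpace Ω'] {P' : Measure Ω'} [IsProbabilityMeasure P']

/-- **INDEPENDENT VECTOR COMPONENTS CONVERGE JOINTLY.**  `Xₙ ⇒ Z₁` in `E`, `Yₙ ⇒ Z₂` in `F`,
`Xₙ ⟂ Yₙ` for every `n`, `Z₁ ⟂ Z₂` ⇒ `(Xₙ, Yₙ) ⇒ (Z₁, Z₂)` in `E × F`. [ours] -/
theorem tendstoInDistribution_prodMk_of_indepFun_vector {X : ℕ → Ω → E} {Y : ℕ → Ω → F}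
    {Z₁ : Ω' → E} {Z₂ : Ω' → F}
    (hX : TendstoInDistribution X atTop Z₁ (fun _ => P) P')
    (hY : TendstoInDistribution Y atTop Z₂ (fun _ => P) P')
    (hXY : ∀ n, IndepFun (X n) (Y n) P) (hZ : IndepFun Z₁ Z₂ P') :
    TendstoInDistribution (fun n ω => (X n ω, Y n ω)) atTop (fun ω' => (Z₁ ω', Z₂ ω'))
      (fun _ => P) P' := by
  haveI : SecondCountableTopology E := secondCountable_of_proper
  haveI : SecondCountableTopology F := secondCountable_of_proper
  have hVm : ∀ n, AEMeasurable (fun ω => toLp 2 (X n ω, Y n ω)) P := fun n =>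
    (measurable_toLp 2 (E × F)).comp_aemeasurable
      ((hX.forall_aemeasurable n).prodMk (hY.forall_aemeasurable n))
  have hVZ : AEMeasurable (fun ω' => toLp 2 (Z₁ ω', Z₂ ω')) P' :=
    (measurable_toLp 2 (E × F)).comp_aemeasurable
      (hX.aemeasurable_limit.prodMk hY.aemeasurable_limit)
  have hV : TendstoInDistribution (fun n ω => toLp 2 (X n ω, Y n ω)) atTop
      (fun ω' => toLp 2 (Z₁ ω', Z₂ ω')) (fun _ => P) P' := by
    refine tendstoInDistribution_of_forall_inner (P := fun _ => P) hVm hVZ fun t => ?_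
    have hms : Measurable fun x : E => ⟪(ofLp t).1, x⟫ := (continuous_const.inner continuous_id).measurable
    have hmt : Measurable fun y : F => ⟪(ofLp t).2, y⟫ := (continuous_const.inner continuous_id).measurable
    have h1 : TendstoInDistribution (fun n ω => ⟪(ofLp t).1, X n ω⟫) atTop
        (fun ω' => ⟪(ofLp t).1, Z₁ ω'⟫) (fun _ => P) P' :=
      hX.continuous_comp (continuous_const.inner continuous_id)
    have h2 : TendstoInDistribution (fun n ω => ⟪(ofLp t).2, Y n ω⟫) atTop
        (fun ω' => ⟪(ofLp t).2, Z₂ ω'⟫) (fun _ => P) P' :=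
      hY.continuous_comp (continuous_const.inner continuous_id)
    have hsum := tendstoInDistribution_add_of_indepFun h1 h2
      (fun n => (hXY n).comp hms hmt) (hZ.comp hms hmt)
    refine hsum.congr (fun n => Eventually.of_forall fun ω => ?_)
      (Eventually.of_forall fun ω' => ?_)
    · show ⟪(ofLp t).1, X n ω⟫ + ⟪(ofLp t).2, Y n ω⟫ = ⟪t, toLp 2 (X n ω, Y n ω)⟫
      rw [prod_inner_apply]
    · show ⟪(ofLp t).1, Z₁ ω'⟫ + ⟪(ofLp t).2, Z₂ ω'⟫ = ⟪t, toLp 2 (Z₁ ω', Z₂ ω')⟫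
      rw [prod_inner_apply]
  exact hV.continuous_comp (prod_continuous_ofLp 2 E F)

end Joint

/-! ## §3 Two codes on the product space -/

section TwoCodes

variable {E : Type*} [NormedAddCommGroup E] [InnerProductSpace ℝ E] [FiniteDimensional ℝ E]
  [MeasurableSpace E] [BorelSpace E]
variable {F : Type*} [NormedAddCommGroup F] [InnerProductSpace ℝ F] [FiniteDimensional ℝ F]
  [MeasurableSpace F] [BorelSpace F]
variable {ΩA : Type*} [MeasurableSpace ΩA] {PA : Measure ΩA} [IsProbabilityMeasure PA]
variable {ΩB : Type*} [MeasurableSpace ΩB] {PB : Measure ΩB} [IsProbabilityMeasure PB]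
variable {Ω' : Type*} [MeasurableSpace Ω'] {P' : Measure Ω'} [IsProbabilityMeasure P']

/-- **TWO INDEPENDENT CODES' VECTOR STATISTICS CONVERGE JOINTLY**: `Xₙ ⇒ Z₁` in `E` under `P_A`,
`Yₙ ⇒ Z₂` in `F` under `P_B`, `Z₁ ⟂ Z₂` ⇒ `(ω_A, ω_B) ↦ (Xₙ(ω_A), Yₙ(ω_B)) ⇒ (Z₁, Z₂)` under
`P_A ⊗ P_B`. [ours] -/
theorem tendstoInDistribution_prodMk_twoCodes_vector {X : ℕ → ΩA → E} {Y : ℕ → ΩB → F}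
    {Z₁ : Ω' → E} {Z₂ : Ω' → F} (hX : TendstoInDistribution X atTop Z₁ (fun _ => PA) P')
    (hY : TendstoInDistribution Y atTop Z₂ (fun _ => PB) P') (hZ : IndepFun Z₁ Z₂ P') :
    TendstoInDistribution (fun n (ω : ΩA × ΩB) => (X n ω.1, Y n ω.2)) atTop
      (fun ω' => (Z₁ ω', Z₂ ω')) (fun _ => PA.prod PB) P' :=
  tendstoInDistribution_prodMk_of_indepFun_vector (tendstoInDistribution_vector_comp_fst hX)
    (tendstoInDistribution_vector_comp_snd hY)
    (fun n => indepFun_prod₀ (hX.forall_aemeasurable n) (hY.forall_aemeasurable n)) hZ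

end TwoCodes

end Summit.Ventures.LatticeQCDFlow.Scoring.CardConsistency

end
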